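import Mathlib
import Literature.Computability.AlgebraicComplexity.AlderStrassen

/-!
# Rank `≤ |ι|` tensors lie in the closure of the open `GL³`-orbit of the unit tensor (stub `stub_orbitClosure`)

Line `unit-tensor-orbit-nuclear-ratio` for the crux `FidelityWitnesses.DiagonalPowerDecay`
(`stmt-MatrixMultiplication-14053`).

In the format `(ℂ^ι)^{⊗3}`, a tensor `S` with `tensorRank S ≤ |ι|` is a sum of exactly `|ι|` triads
(`exists_eq_sum_triad_of_tensorRank_le`, padding with zero triads); collecting the factors as the columns of
three matrices `A B C : Matrix ι ι ℂ` (after the bijection `Fintype.equivFin ι`) writes it as the image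
`(A,B,C)·I_ι = fun a b c => Σ_l A a l * B b l * C c l` of the unit tensor `I_ι = Σ_l e_l ⊗ e_l ⊗ e_l`.
Along the complex line `s ↦ (1 - s)•1 + s•M` through `1` (`s = 0`) and `M` (`s = 1`) the determinant is a
polynomial in `s` with value `1` at `s = 0`, hence non-zero with finitely many roots; off the (finite) union of
the three root sets the perturbed triple `(A_s, B_s, C_s)` consists of invertible matrices, the complement of a
finite subset of `ℂ` is dense, and `s ↦ (A_s,B_s,C_s)·I_ι` is continuous with value `S` at `s = 1`, so `S` lies
in the closure of the open orbit `{(A,B,C)·I_ι : A, B, C invertible}`.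

Main result: `stub_orbitClosure`. The polynomial-line device (`linePoly`, `eval_det_linePoly`,
`det_linePoly_ne_zero`) is adapted from the tree's `Literature/LinearAlgebra/Matrix/GLPathConnected.lean`.

Supports item `stmt-MatrixMultiplication-14053`; no definitions.
-/

set_option linter.dupNamespace false

namespace Summit.MatrixMultiplication.MatrixMultiplication.Theorems.DiagonalPowerDecay

open scoped BigOperators Polynomial
open Literature.Computability.AlgebraicComplexity

section Line

variable {ι : Type} [Fintype ι] [DecidableEq ι]

/-- The complex line of matrices `s ↦ (1 - s) • 1 + s • M` through `1` and `M`, as a matrix of polynomials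
(adapted from `Literature.LinearAlgebra.Matrix.linePoly`). [folklore] -/
theorem eval_linePoly (M : Matrix ι ι ℂ) (s : ℂ) :
    (Polynomial.evalRingHom s).mapMatrix
        ((1 - (Polynomial.X : ℂ[X])) • (1 : Matrix ι ι ℂ[X]) + (Polynomial.X : ℂ[X]) • M.map Polynomial.C) =
      (1 - s) • (1 : Matrix ι ι ℂ) + s • M := by
  -- adapted from Literature/LinearAlgebra/Matrix/GLPathConnected.lean (`eval_linePoly`)
  ext i j
  simp [Matrix.map_apply, Matrix.smul_apply, Matrix.one_apply, Matrix.add_apply]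
  split_ifs <;> simp [mul_comm]

/-- `det ((1 - s) • 1 + s • M)` is the value at `s` of the polynomial `det ((1 - X) • 1 + X • M)`. [folklore] -/
theorem eval_det_linePoly (M : Matrix ι ι ℂ) (s : ℂ) :
    ((1 - (Polynomial.X : ℂ[X])) • (1 : Matrix ι ι ℂ[X]) + (Polynomial.X : ℂ[X]) • M.map Polynomial.C).det.eval s =
      ((1 - s) • (1 : Matrix ι ι ℂ) + s • M).det := by
  -- adapted from Literature/LinearAlgebra/Matrix/GLPathConnected.lean (`eval_det_linePoly`)
  rw [← Polynomial.coe_evalRingHom, RingHom.map_det, eval_linePoly]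

/-- The determinant along the line is a non-zero polynomial (its value at `s = 0` is `det 1 = 1`). [folklore] -/
theorem det_linePoly_ne_zero (M : Matrix ι ι ℂ) :
    ((1 - (Polynomial.X : ℂ[X])) • (1 : Matrix ι ι ℂ[X]) + (Polynomial.X : ℂ[X]) • M.map Polynomial.C).det ≠ 0 := by
  -- adapted from Literature/LinearAlgebra/Matrix/GLPathConnected.lean (`det_linePoly_ne_zero`)
  intro h
  have := eval_det_linePoly M 0
  rw [h, Polynomial.eval_zero] at this
  simp at this

/-- Off the (finite) root set of `det ((1 - X) • 1 + X • M)`, the matrix `(1 - s) • 1 + s • M` is invertible.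
[folklore] -/
theorem isUnit_det_line_of_not_isRoot (M : Matrix ι ι ℂ) {s : ℂ}
    (hs : ¬ ((1 - (Polynomial.X : ℂ[X])) • (1 : Matrix ι ι ℂ[X]) +
      (Polynomial.X : ℂ[X]) • M.map Polynomial.C).det.IsRoot s) :
    IsUnit ((1 - s) • (1 : Matrix ι ι ℂ) + s • M).det := by
  rw [Polynomial.IsRoot.def, eval_det_linePoly] at hs
  exact isUnit_iff_ne_zero.2 hs

/-- A tensor of rank `≤ |ι|` in the format `ι³` is the image `(A,B,C)·I_ι` of the unit tensor under a triple
of matrices: the `|ι|` triads of a decomposition (`exists_eq_sum_triad_of_tensorRank_le`) become the columns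
after the bijection `Fintype.equivFin ι`. [folklore] -/
theorem exists_matrix_eq_of_tensorRank_le_card (S : ι → ι → ι → ℂ) (hS : tensorRank S ≤ Fintype.card ι) :
    ∃ A B C : Matrix ι ι ℂ, S = fun a b c => ∑ l, A a l * B b l * C c l := by
  obtain ⟨w, u, v, h⟩ := exists_eq_sum_triad_of_tensorRank_le hS
  set e := Fintype.equivFin ι with he
  refine ⟨Matrix.of fun a l => w (e l) a, Matrix.of fun b l => u (e l) b, Matrix.of fun c l => v (e l) c, ?_⟩
  funext a b c
  rw [h]
  simp only [Finset.sum_apply, triad_apply, Matrix.of_apply]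
  exact (e.sum_comp (fun i => w i a * u i b * v i c)).symm

end Line

/-- **Stub `stub_orbitClosure` — one orbit: rank `≤ |ι|` tensors are limits of the open `GL³`-orbit of the
unit tensor.** `tensorRank S ≤ |ι|` gives `S = (A,B,C)·I_ι` (`exists_matrix_eq_of_tensorRank_le_card`); along
the line `s ↦ ((1-s)•1 + s•A, (1-s)•1 + s•B, (1-s)•1 + s•C)` the three determinants are non-zero polynomials in
`s`, so all three matrices are invertible off a finite set `Z ⊂ ℂ`, whose complement is dense; the orbit map is
continuous in `s` with value `S` at `s = 1 ∈ closure Zᶜ`, whence `S ∈ closure (GL³·I_ι)` (`map_mem_closure`).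
[folklore] -/
theorem stub_orbitClosure :
    ∀ (ι : Type) [Fintype ι] [DecidableEq ι] (S : ι → ι → ι → ℂ),
      tensorRank S ≤ Fintype.card ι →
        S ∈ closure {S' : ι → ι → ι → ℂ | ∃ A B C : Matrix ι ι ℂ,
          IsUnit A.det ∧ IsUnit B.det ∧ IsUnit C.det ∧ S' = fun a b c => ∑ l, A a l * B b l * C c l} := by
  intro ι _ _ S hS
  obtain ⟨A, B, C, hABC⟩ := exists_matrix_eq_of_tensorRank_le_card S hS
  -- the line of matrices through `1` and `M`
  let L : Matrix ι ι ℂ → ℂ → Matrix ι ι ℂ := fun M s => (1 - s) • (1 : Matrix ι ι ℂ) + s • M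
  have hL1 : ∀ M : Matrix ι ι ℂ, L M 1 = M := fun M => by simp [L]
  have hLc : ∀ M : Matrix ι ι ℂ, Continuous (L M) := fun M => by
    show Continuous fun s : ℂ => (1 - s) • (1 : Matrix ι ι ℂ) + s • M
    fun_prop
  -- the determinant polynomials and the finite bad set
  let P : Matrix ι ι ℂ → ℂ[X] := fun M =>
    ((1 - (Polynomial.X : ℂ[X])) • (1 : Matrix ι ι ℂ[X]) + (Polynomial.X : ℂ[X]) • M.map Polynomial.C).det
  let Z : Set ℂ := {s | (P A).IsRoot s} ∪ {s | (P B).IsRoot s} ∪ {s | (P C).IsRoot s}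
  have hZ : Z.Finite :=
    ((Polynomial.finite_setOf_isRoot (det_linePoly_ne_zero A)).union
      (Polynomial.finite_setOf_isRoot (det_linePoly_ne_zero B))).union
      (Polynomial.finite_setOf_isRoot (det_linePoly_ne_zero C))
  have hdense : Dense Zᶜ := hZ.countable.dense_compl ℂ
  -- the orbit map along the line
  let F : ℂ → ι → ι → ι → ℂ := fun s a b c => ∑ l, L A s a l * L B s b l * L C s c l
  have hF : Continuous F := by
    refine continuous_pi fun a => continuous_pi fun b => continuous_pi fun c => ?_
    refine continuous_finsetSum _ fun l _ => ?_
    exact (((hLc A).matrix_elem a l).mul ((hLc B).matrix_elem b l)).mul ((hLc C).matrix_elem c l)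
  have hF1 : F 1 = S := by
    rw [hABC]
    funext a b c
    simp only [F, hL1]
  have hmaps : Set.MapsTo F Zᶜ {S' : ι → ι → ι → ℂ | ∃ A B C : Matrix ι ι ℂ,
      IsUnit A.det ∧ IsUnit B.det ∧ IsUnit C.det ∧ S' = fun a b c => ∑ l, A a l * B b l * C c l} := by
    intro s hs
    simp only [Z, Set.mem_compl_iff, Set.mem_union, Set.mem_setOf_eq, not_or] at hs
    obtain ⟨⟨hsA, hsB⟩, hsC⟩ := hs
    exact ⟨L A s, L B s, L C s, isUnit_det_line_of_not_isRoot A hsA, isUnit_det_line_of_not_isRoot B hsB,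
      isUnit_det_line_of_not_isRoot C hsC, rfl⟩
  have h1 : (1 : ℂ) ∈ closure Zᶜ := hdense 1
  rw [← hF1]
  exact map_mem_closure hF h1 hmaps

end Summit.MatrixMultiplication.MatrixMultiplication.Theorems.DiagonalPowerDecay
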